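import Summits.BirchSwinnertonDyer.Rank1Residual.Iwasawa.NonsingularReductionTowerInputs
import HarnessLib

/-!
# BSD rank-≤1 residual cell — `E₀(K_{∞,η})[p^∞]` is `p`-divisible at a finite place `v ∤ p`
# that is not split completely in the `ℤ_p`-extension (TOOL; row T-CTL-L1, FILE 1b)

HONEST FRAMING (cell `b2b-bsdres-*`, team n1011, verbatim): prove what is provable now; shrink each
hard class to its core with data; no claim beyond stated classes. Research route; TOOL theorems
only — no definition, no named fact, nothing booked, no residual-map mark moved, no class closed.
Row T-CTL-L1 of `cells/n1011/OWNERS.md` (seat n1011-p12 GEN 12; idle rule R3-25 (f); lead R5-94 (c):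
a stand-alone K-general TOOL — the input `(L1)` named in ROUTE-2 §II.42.2 for the SHARP form of
Greenberg's Lemma 3.3 at `v ∤ p`, in the `localPoints` currency of
`Iwasawa/LocalTowerKernelCardLeTorsion.lean` (row T-CTL-TAM F2, p314053); row T-CTL-TAM's F6 does not
consume it).

R. Greenberg, *Iwasawa theory for elliptic curves*, LNM 1716 (1999), §3, proof of Lemma 3.3
(p. 87): `ker(r_v) ≅ B_v/(γ_v − 1)B_v` with `B_v = E(K_η)[p^∞]`, whose maximal divisible subgroup is
swallowed by `(γ_v − 1)B_v`; the SHARP count `c_v^{(p)}` (§4, p. 74) needs `(γ_v − 1)` ONTO the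
`E₀`-part of `B_v`, i.e. that `E₀(K_η)[p^∞] ≅ Ẽ_ns(k_η)[p^∞]` is `p`-DIVISIBLE — true because the
residue field `k_η` of `K_η = K_{∞,η}` is the `ℤ_p`-extension of `k_v`, over which `k̄_v` has
pro-degree prime to `p` (Coates, LNM 1716, proof of Lemma 3.8: "the profinite degree of `F_v^{nr}`
over `K_∞` is prime to `p`"). Here, for `E = W` elliptic over ANY number field `K`, ANY
`ℤ_p`-extension `κ`, ANY reduction type at `v ∤ p`, and `v` NOT split completely in `K_∞/K`
(`hns : ∃ σ ∈ Γ_{K_v}, σ ∉ Hi`; discharged for the cyclotomic `κ` by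
`exists_not_mem_localSubgroup_of_isCyclotomic` of the sibling file):

* `exists_nsmul_eq_of_forall_smul_eq` — every `Hi`-fixed `P ∈ E(K̄_v)` of `p`-power order whose
  transport to the local minimal model has non-singular reduction is `p • Q` for such a `Q`;
* `exists_nsmul_eq_of_mem_primaryComponent` — the same for `B = M_∞[p^∞]`,
  `M_∞ = E(K̄_v)^{Hi}` (`FixedPoints.addSubgroup`, `AddCommGroup.primaryComponent`): the pointwise
  divisibility `hdiv` that `PrimaryGroup.le_range_of_finite_ker` /
  `X11b.TamagawaCoinvariants.natCard_primaryComponent_quotient_range_le` consume.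

PROOF (re-proved from theorems of the tree; no named fact): a `p`-th root `Q₀ ∈ E₀(K̄_v)` of `P`
exists (X11b `localDivisible_nonsingular_torsion`); `Γ_{K_v} = F^ℕ · I_𝔐 · U` for an arithmetic
Frobenius `F` and every open `U` (`exists_eq_frobenius_pow_mul_inertia_mul`) and inertia fixes the
`p`-power torsion of `E₀` (`map_inertia_eq_of_zsmul_eq_zero_of_reducesToNonsingular`, VII.3.1), so
every `σ` acts on the `F`-orbit of `Q₀` as a power `F^{n_σ}` with `κ(σ) ≡ n_σ κ(F) (mod p^N)`;
`κ(F) ≠ 0` (from `hns`), so for `h ∈ Hi` one gets `p^S ∣ n_h`: `Hi` moves `Q₀` inside the orbit of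
`ψ = F^{p^S}`, of length `f′` PRIME TO `p`; the affine average `Q = d″ • Σ_{i<f′} ψ^i • Q₀`
(`d″f′ ≡ 1 mod p^{k+1}`) is `Hi`-fixed, lies in `E₀`, and `p • Q = (d″f′) • P = P` since `ψ` fixes
`P` (a point of a finite layer, `exists_layer_le_stabilizer`). NOT claimed: the split-completely case
(there the statement is false and `𝒦_{v,0} = ⊥`, tree `localTowerKer_eq_bot_of_forall_mem`);
`v ∣ p`; any count of `B/(g − 1)B` (row T-CTL-TAM's, seat p06). Axioms standard.

References: [GreenbergLNM1716] §3 Lemma 3.3 (proof, p. 87), §4 (p. 74); [SilvermanAEC2009]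
VII.2.1, VII.3.1, VIII.§1.
-/

noncomputable section

open scoped Classical NNReal

open NumberField IsDedekindDomain Field

universe u

namespace Summit.BirchSwinnertonDyer.Rank1Residual.Iwasawa.NonsingularTower

open Literature.NumberTheory.EllipticCurves Literature.NumberTheory.GaloisRepresentations
  IsDedekindDomain.HeightOneSpectrum WeierstrassCurve
  Summit.BirchSwinnertonDyer.Rank1Residual.X11b.AcSelmer

variable {K : Type u} [Field K] [NumberField K] (W : WeierstrassCurve K)
  {v : HeightOneSpectrum (𝓞 K)} {p : ℕ} [Fact p.Prime] (κ : ZpExtension K p)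
  {w : Valuation (AlgebraicClosure (v.adicCompletion K)) ℝ≥0}
  (hw : ∀ x, (w x : ℝ) =
    spectralNorm (v.adicCompletion K) (AlgebraicClosure (v.adicCompletion K)) x)
  {Φ : localPoints W (v.adicCompletion K) ≃+
    (((W.localMinimalIntegralModel v).map (algebraMap (v.adicCompletionIntegers K)
      (v.adicCompletion K))).baseChange (AlgebraicClosure (v.adicCompletion K))).toAffine.Point}
  (hΦ : ∀ (σ : absoluteGaloisGroup (v.adicCompletion K)) (Q : localPoints W (v.adicCompletion K)),
    Φ (σ • Q) = Affine.Point.map ((absoluteGaloisGroup.toAlgEquiv _ σ :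
        AlgebraicClosure (v.adicCompletion K) ≃ₐ[v.adicCompletion K]
          AlgebraicClosure (v.adicCompletion K)) :
        AlgebraicClosure (v.adicCompletion K) →ₐ[v.adicCompletion K]
          AlgebraicClosure (v.adicCompletion K)) (Φ Q))

/-! ## The main theorem: `E₀(K_{∞,η})[p^∞]` is `p`-divisible when `v ∤ p` is not split completely -/

section Main

include hw hΦ in
set_option maxHeartbeats 1600000 in
/-- **`E₀(K_{∞,η})[p^∞]` is `p`-divisible at a finite place `v ∤ p` that is NOT split completely in
the `ℤ_p`-extension `K_∞/K`** (any number field `K`, any `ℤ_p`-extension `κ`, any reduction type;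
Greenberg, LNM 1716, §3, proof of Lemma 3.3, p. 87: the structure of `B_v = E(K_η)[p^∞]` and its
maximal divisible subgroup; Coates, LNM 1716, proof of Lemma 3.8: "the profinite degree of `F_v^{nr}`
over `K_∞` is prime to `p`"). In the `localPoints` currency of `Iwasawa/LocalTowerKernelCardLeTorsion`:
let `Hi = (Γ_{K_v} → Γ_K)⁻¹(Gal(K̄/K_∞)) = Gal(K̄_v/K_{∞,η})`, `Φ` an equivariant transport of
`E(K̄_v)` to the local minimal model at `v`, and suppose some `σ ∈ Γ_{K_v}` is NOT in `Hi`. Then every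
`Hi`-fixed `P ∈ E(K̄_v)` of `p`-power order whose transport has non-singular reduction is `p • Q` for
an `Hi`-fixed `Q` of `p`-power order with non-singular reduction. PROOF (re-proved from tree theorems,
no named fact): `Q₀ ∈ E₀(K̄_v)` with `p • Q₀ = P` exists (X11b `localDivisible_nonsingular_torsion`);
`Γ_{K_v} = F^ℕ · I_𝔐 · U` for an arithmetic Frobenius `F` and every open `U`
(`exists_eq_frobenius_pow_mul_inertia_mul`), inertia fixes the `p`-power torsion of `E₀`
(`map_inertia_eq_of_zsmul_eq_zero_of_reducesToNonsingular`), so every `σ` acts on the `F`-orbit of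
`Q₀` as a power `F^{n_σ}` with `κ(σ) ≡ n_σ κ(F) (mod p^N)`; for `h ∈ Hi` this forces `p^S ∣ n_h`, so
`Hi` moves `Q₀` inside the orbit of `ψ = F^{p^S}`, whose length `f′` is prime to `p`; the affine
average `Q = d″ • Σ_{i<f′} ψ^i • Q₀` (`d″ f′ ≡ 1 mod p^{k+1}`) is `Hi`-fixed, lies in `E₀`, and
`p • Q = d″ f′ • P = P` because `ψ` fixes `P` (which lies in a finite layer).
[cite: GreenbergLNM1716, §3 Lemma 3.3 (proof, p. 87)] -/
theorem exists_nsmul_eq_of_forall_smul_eq [W.IsElliptic] (hpv : (p : 𝓞 K) ∉ v.asIdeal)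
    (hns : ∃ σ : absoluteGaloisGroup (v.adicCompletion K),
      σ ∉ localSubgroup κ.kerSubgroup (v.adicCompletion K))
    (P : localPoints W (v.adicCompletion K))
    (hPfix : ∀ σ ∈ localSubgroup κ.kerSubgroup (v.adicCompletion K), σ • P = P)
    (hP₀ : ReducesToNonsingular w (IsLocalRing.residue w.integer) (Φ P))
    (hPtors : ∃ k : ℕ, p ^ k • P = 0) :
    ∃ Q : localPoints W (v.adicCompletion K),
      (∀ σ ∈ localSubgroup κ.kerSubgroup (v.adicCompletion K), σ • Q = Q) ∧
        ReducesToNonsingular w (IsLocalRing.residue w.integer) (Φ Q) ∧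
          (∃ k : ℕ, p ^ k • Q = 0) ∧ p • Q = P := by
  -- notation and basic facts
  let G : Type u := absoluteGaloisGroup (v.adicCompletion K)
  let Pt : Type u := localPoints W (v.adicCompletion K)
  let Hi : Subgroup G := localSubgroup κ.kerSubgroup (v.adicCompletion K)
  have hp : (p : ℕ).Prime := Fact.out
  haveI : CharZero (v.adicCompletion K) :=
    charZero_of_injective_algebraMap (algebraMap K (v.adicCompletion K)).injective
  obtain ⟨𝔐, h𝔐⟩ := v.localPrimesAbove_nonempty
  have hpunit : IsUnit ((p : ℕ) : (v.adicCompletionIntegers K)) := by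
    have h := isUnit_algebraMap_adicCompletionIntegers K v hpv
    rwa [map_natCast] at h
  haveI hint := WeierstrassCurve.isIntegral_spectralValuation_baseChange hw
    (W.localMinimalIntegralModel v)
  obtain ⟨W₀, hW₀⟩ := hint.integral
  -- the local character `λ = κ ∘ (Γ_{K_v} → Γ_K)`, additively
  let lam : G → ℤ_[p] := fun x ↦ (κ (resGal (K := K) (v.adicCompletion K) x)).toAdd
  have hlam_mul : ∀ x y : G, lam (x * y) = lam x + lam y := fun x y ↦ by
    show (κ (resGal (K := K) _ (x * y))).toAdd = (κ (resGal (K := K) _ x)).toAdd +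
      (κ (resGal (K := K) _ y)).toAdd
    rw [map_mul, map_mul, toAdd_mul]
  have hlam_pow : ∀ (x : G) (n : ℕ), lam (x ^ n) = (n : ℤ_[p]) * lam x := fun x n ↦ by
    show (κ (resGal (K := K) _ (x ^ n))).toAdd = (n : ℤ_[p]) * (κ (resGal (K := K) _ x)).toAdd
    rw [map_pow, map_pow, toAdd_pow, nsmul_eq_mul]
  have hlam_Hi : ∀ x : G, x ∈ Hi ↔ lam x = 0 := fun x ↦ by
    show x ∈ localSubgroup κ.kerSubgroup (v.adicCompletion K) ↔ _
    rw [mem_localSubgroup_iff, ZpExtension.mem_kerSubgroup]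
    constructor
    · intro h
      show (κ (resGal (K := K) _ x)).toAdd = 0
      rw [h, toAdd_one]
    · intro h
      exact Multiplicative.toAdd.injective (by rw [toAdd_one]; exact h)
  have hlam_layer : ∀ (x : G) (n : ℕ),
      x ∈ localSubgroup (κ.layerSubgroup n) (v.adicCompletion K) ↔ (p : ℤ_[p]) ^ n ∣ lam x :=
    fun x n ↦ by rw [mem_localSubgroup_iff, ZpExtension.mem_layerSubgroup]
  -- inertia lies in `Hi` (`ℤ_p`-extensions are unramified outside `p`)
  have hI : ∀ σ ∈ 𝔐.inertia G, σ ∈ Hi := fun σ hσ ↦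
    (mem_localSubgroup_iff _ _ σ).mpr
      (ZpExtension.inertia_le_kerSubgroup_holds K p κ hpv (primeBelow_mem_primesAbove h𝔐)
        (v.resGalOfEmb_mem_inertia_primeBelow (closureEmb (K := K) (v.adicCompletion K)) 𝔐 hσ))
  -- the subgroup `E₀` and its stability
  obtain ⟨S, hS⟩ := exists_addSubgroup_mem_iff_reducesToNonsingular W hw Φ
  have hSsmul : ∀ (σ : G) (Q : Pt), Q ∈ S → σ • Q ∈ S := fun σ Q hQ ↦
    (hS _).mpr ((reducesToNonsingular_transport_smul_iff W hw hΦ σ Q).mpr ((hS Q).mp hQ))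
  have hSpow : ∀ (σ : G) (n : ℕ) (Q : Pt), Q ∈ S → σ ^ n • Q ∈ S := by
    intro σ n Q hQ
    induction n with
    | zero => rwa [pow_zero, one_smul]
    | succ n ih => rw [pow_succ', mul_smul]; exact hSsmul σ _ ih
  -- inertia fixes the `p`-power torsion points of `E₀`
  have hIfix : ∀ (Q : Pt), Q ∈ S → ∀ k : ℕ, p ^ k • Q = 0 →
      ∀ τ ∈ 𝔐.inertia G, τ • Q = Q := by
    intro Q hQ k hk τ hτ
    have hn : w ((((p ^ k : ℕ) : ℤ)) : AlgebraicClosure (v.adicCompletion K)) = 1 := by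
      rw [Int.cast_natCast, Nat.cast_pow, map_pow, spectralValuation_natCast_eq_one_of_isUnit hw
        hpunit, one_pow]
    apply Φ.injective
    rw [hΦ]
    exact map_inertia_eq_of_zsmul_eq_zero_of_reducesToNonsingular hw hW₀ h𝔐 ((hS Q).mp hQ) hn
      (by rw [natCast_zsmul, ← map_nsmul, hk, map_zero]) hτ
  -- (1) a `p`-th root `Q₀ ∈ E₀(K̄_v)` of `P`
  obtain ⟨k, hk⟩ := hPtors
  obtain ⟨Q', hQ'₀, hQ'P⟩ := localDivisible_nonsingular_torsion W v hpv w hw 𝔐 h𝔐 (Φ P)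
    (fun τ hτ ↦ by rw [← hΦ, hPfix τ (hI τ hτ)]) hP₀ ⟨k, by rw [← map_nsmul, hk, map_zero]⟩
  obtain ⟨Q₀, hQ₀⟩ : ∃ Q₀ : Pt, Φ Q₀ = Q' := ⟨Φ.symm Q', Φ.apply_symm_apply Q'⟩
  have hQ₀S : Q₀ ∈ S := (hS Q₀).mpr (hQ₀ ▸ hQ'₀)
  have hpQ₀ : p • Q₀ = P := Φ.injective (by rw [map_nsmul, hQ₀, hQ'P])
  have hQ₀tors : p ^ (k + 1) • Q₀ = 0 := by rw [pow_succ, mul_smul, hpQ₀, hk]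
  have hPtors' : p ^ (k + 1) • P = 0 := by rw [pow_succ', mul_smul, hk, smul_zero]
  -- (2) an arithmetic Frobenius `F`, `λ F ≠ 0`
  obtain ⟨F, hF⟩ := v.exists_isArithFrobAt_localAbsIntegers h𝔐
  have hlamF : lam F ≠ 0 := by
    intro h0
    obtain ⟨σ₀, hσ₀⟩ := hns
    apply hσ₀
    rw [hlam_Hi]
    apply padicInt_eq_zero_of_forall_pow_dvd (p := p)
    intro N
    obtain ⟨n, τ, u, hτ, hu, rfl⟩ := v.exists_eq_frobenius_pow_mul_inertia_mul h𝔐 hF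
      (isOpen_localSubgroup_layerSubgroup (v.adicCompletion K) κ N) σ₀
    rw [hlam_mul, hlam_mul, hlam_pow, h0, mul_zero, zero_add, (hlam_Hi τ).mp (hI τ hτ), zero_add]
    exact (hlam_layer u N).mp hu
  obtain ⟨m, hm⟩ : ∃ m : ℕ, ∃ uF : ℤ_[p]ˣ, lam F = (uF : ℤ_[p]) * (p : ℤ_[p]) ^ m :=
    ⟨(lam F).valuation, PadicInt.unitCoeff hlamF, PadicInt.unitCoeff_spec hlamF⟩
  obtain ⟨uF, huF⟩ := hm
  -- (2') an `F`-period `f ≥ 1` of `Q₀`, `f = p^r · f'` with `p ∤ f'`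
  haveI : Finite (G ⧸ MulAction.stabilizer G Q₀) :=
    Subgroup.quotient_finite_of_isOpen _
      (Literature.NumberTheory.EllipticCurves.isOpen_stabilizer_localPoints W _ Q₀)
  obtain ⟨f, hf1, hfQ₀⟩ : ∃ f : ℕ, 1 ≤ f ∧ F ^ f • Q₀ = Q₀ := by
    obtain ⟨a, b, hab, heq⟩ := Finite.exists_ne_map_eq_of_infinite
      (fun j : ℕ ↦ ((F ^ j : G) : G ⧸ MulAction.stabilizer G Q₀))
    wlog hlt : a < b generalizing a b
    · exact this b a hab.symm heq.symm (lt_of_le_of_ne (not_lt.mp hlt) hab.symm)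
    refine ⟨b - a, Nat.one_le_iff_ne_zero.mpr (Nat.sub_ne_zero_of_lt hlt), ?_⟩
    have hmem : (F ^ a)⁻¹ * F ^ b ∈ MulAction.stabilizer G Q₀ := QuotientGroup.eq.mp heq
    have he : (F ^ a)⁻¹ * F ^ b = F ^ (b - a) := by
      rw [inv_mul_eq_iff_eq_mul, ← pow_add, Nat.add_sub_cancel' hlt.le]
    rw [he] at hmem
    exact hmem
  obtain ⟨r, f', hf', hff'⟩ := Nat.exists_eq_pow_mul_and_not_dvd (Nat.one_le_iff_ne_zero.mp hf1) p
    hp.ne_one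
  have hperQ₀ : ∀ c : ℕ, F ^ (f * c) • Q₀ = Q₀ := by
    intro c
    induction c with
    | zero => rw [mul_zero, pow_zero, one_smul]
    | succ c ih => rw [Nat.mul_succ, pow_add, mul_smul, hfQ₀, ih]
  have hmodQ₀ : ∀ j : ℕ, F ^ j • Q₀ = F ^ (j % f) • Q₀ := by
    intro j
    conv_lhs => rw [← Nat.mod_add_div j f, pow_add, mul_smul, hperQ₀]
  -- (3) `P` lies in a finite layer; the exponent `S` and the open subgroup `U`
  obtain ⟨n₀, hn₀⟩ := exists_layer_le_stabilizer W κ P hPfix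
  obtain ⟨S', hS'⟩ : ∃ S' : ℕ, r ≤ S' ∧ n₀ ≤ S' := ⟨max r n₀, le_max_left _ _, le_max_right _ _⟩
  let U₀ : Subgroup G := ⨅ j : Fin f, MulAction.stabilizer G (F ^ (j : ℕ) • Q₀)
  have hU₀open : IsOpen (U₀ : Set G) := by
    rw [Subgroup.coe_iInf]
    exact isOpen_iInter_of_finite fun j ↦
      Literature.NumberTheory.EllipticCurves.isOpen_stabilizer_localPoints W _ _
  have hU₀fix : ∀ u ∈ U₀, ∀ j : ℕ, u • F ^ j • Q₀ = F ^ j • Q₀ := by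
    intro u hu j
    rw [hmodQ₀ j]
    have hj : j % f < f := Nat.mod_lt j hf1
    exact (Subgroup.mem_iInf.mp hu) ⟨j % f, hj⟩
  let U : Subgroup G := U₀ ⊓ localSubgroup (κ.layerSubgroup (m + S')) (v.adicCompletion K)
  have hUopen : IsOpen (U : Set G) := by
    rw [Subgroup.coe_inf]
    exact hU₀open.inter (isOpen_localSubgroup_layerSubgroup (v.adicCompletion K) κ (m + S'))
  -- the points `F^j • Q₀` lie in `E₀` and are `p`-power torsion, hence inertia-fixed
  have horbS : ∀ j : ℕ, F ^ j • Q₀ ∈ S := fun j ↦ hSpow F j Q₀ hQ₀S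
  have horbtors : ∀ j : ℕ, p ^ (k + 1) • F ^ j • Q₀ = 0 := fun j ↦ by
    rw [smul_comm, hQ₀tors, smul_zero]
  -- ORBIT LEMMA: every `σ` acts on the `F`-orbit of `Q₀` as `F^{n_σ}`, `λ σ ≡ n_σ λ F (mod p^{m+S'})`
  have horbit : ∀ σ : G, ∃ n : ℕ, (p : ℤ_[p]) ^ (m + S') ∣ lam σ - (n : ℤ_[p]) * lam F ∧
      ∀ j : ℕ, σ • F ^ j • Q₀ = F ^ (n + j) • Q₀ := by
    intro σ
    obtain ⟨n, τ, u, hτ, hu, rfl⟩ := v.exists_eq_frobenius_pow_mul_inertia_mul h𝔐 hF hUopen σ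
    refine ⟨n, ?_, fun j ↦ ?_⟩
    · rw [hlam_mul, hlam_mul, hlam_pow, (hlam_Hi τ).mp (hI τ hτ), add_zero, add_sub_cancel_left]
      exact (hlam_layer u (m + S')).mp (Subgroup.mem_inf.mp hu).2
    · rw [mul_smul, mul_smul, hU₀fix u (Subgroup.mem_inf.mp hu).1 j,
        hIfix _ (horbS j) (k + 1) (horbtors j) τ hτ, ← mul_smul, ← pow_add]
  -- for `h ∈ Hi` the exponent is divisible by `p^S'`
  have hHiexp : ∀ h ∈ Hi, ∃ c : ℕ, ∀ j : ℕ, h • F ^ j • Q₀ = F ^ (p ^ S' * c + j) • Q₀ := by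
    intro h hh
    obtain ⟨n, hdvd, hact⟩ := horbit h
    rw [(hlam_Hi h).mp hh, zero_sub, dvd_neg, huF, pow_add] at hdvd
    have h1 : (p : ℤ_[p]) ^ S' ∣ (n : ℤ_[p]) * (uF : ℤ_[p]) := by
      have h2 : (p : ℤ_[p]) ^ m * (p : ℤ_[p]) ^ S' ∣ ((n : ℤ_[p]) * (uF : ℤ_[p])) * (p : ℤ_[p]) ^ m := by
        rw [mul_assoc]; exact hdvd
      rw [mul_comm ((p : ℤ_[p]) ^ m)] at h2
      have hp0 : (p : ℤ_[p]) ≠ 0 := by exact_mod_cast hp.ne_zero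
      exact (mul_dvd_mul_iff_right (pow_ne_zero m hp0)).mp h2
    have h3 : (p : ℤ_[p]) ^ S' ∣ (n : ℤ_[p]) := (Units.dvd_mul_right).mp h1
    obtain ⟨c, hc⟩ := (pow_dvd_natCast_padicInt_iff (p := p) S' n).mp h3
    exact ⟨c, fun j ↦ by rw [hact j, hc]⟩
  -- `ψ = F^{p^S'}` fixes `P` and `ψ^{f'}` fixes `Q₀`
  have hψP : F ^ (p ^ S') • P = P := by
    apply hn₀
    rw [hlam_layer, hlam_pow]
    exact Dvd.dvd.mul_right (by rw [Nat.cast_pow]; exact pow_dvd_pow _ hS'.2) _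
  have hψQ₀ : F ^ (p ^ S' * f') • Q₀ = Q₀ := by
    have : p ^ S' * f' = f * p ^ (S' - r) := by
      rw [hff', mul_comm (p ^ r), mul_assoc, ← pow_add, Nat.add_sub_cancel' hS'.1, mul_comm]
    rw [this]
    exact hperQ₀ _
  -- the periodic sequence `a i = ψ^i • Q₀`
  let a : ℕ → Pt := fun i ↦ F ^ (p ^ S' * i) • Q₀
  have ha_per : ∀ i, a (i + f') = a i := fun i ↦ by
    show F ^ (p ^ S' * (i + f')) • Q₀ = F ^ (p ^ S' * i) • Q₀
    rw [mul_add, pow_add, mul_smul, hψQ₀]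
  -- the averaging coefficient `d''` with `f' * d'' ≡ 1 (mod p^(k+1))`
  have hcop : Nat.Coprime f' (p ^ (k + 1)) :=
    (((Nat.Prime.coprime_iff_not_dvd hp).mpr hf').symm).pow_right (k + 1)
  obtain ⟨d, -, hd⟩ := Nat.exists_mul_mod_eq_one_of_coprime hcop
    (Nat.one_lt_pow (Nat.succ_ne_zero k) hp.one_lt)
  -- THE POINT
  refine ⟨d • ∑ i ∈ Finset.range f', a i, fun h hh ↦ ?_, ?_, ⟨k + 1, ?_⟩, ?_⟩
  · -- `Hi`-fixed: `h` shifts the sequence `a`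
    obtain ⟨c, hc⟩ := hHiexp h hh
    rw [smul_comm, Finset.smul_sum]
    congr 1
    have : ∀ i, h • a i = a (i + c) := fun i ↦ by
      show h • F ^ (p ^ S' * i) • Q₀ = F ^ (p ^ S' * (i + c)) • Q₀
      rw [hc, mul_add, add_comm]
    simp only [this]
    exact sum_range_add_eq_of_periodic a f' ha_per c
  · -- in `E₀`
    rw [← hS]
    exact S.nsmul_mem (S.sum_mem fun i _ ↦ horbS _) d
  · -- `p`-power torsion
    rw [smul_comm, Finset.smul_sum]
    simp only [a, horbtors, Finset.sum_const_zero, smul_zero]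
  · -- `p • Q = P`
    have hψiP : ∀ i : ℕ, (F ^ (p ^ S')) ^ i • P = P := by
      intro i
      induction i with
      | zero => rw [pow_zero, one_smul]
      | succ i ih => rw [pow_succ, mul_smul, hψP, ih]
    have hsum : ∑ i ∈ Finset.range f', p • a i = f' • P := by
      have : ∀ i ∈ Finset.range f', p • a i = P := fun i _ ↦ by
        show p • F ^ (p ^ S' * i) • Q₀ = P
        rw [smul_comm, hpQ₀, pow_mul, hψiP]
      rw [Finset.sum_congr rfl this, Finset.sum_const, Finset.card_range]
    rw [smul_comm, Finset.smul_sum, hsum, ← mul_smul]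
    obtain ⟨q, hq⟩ : ∃ q, f' * d = p ^ (k + 1) * q + 1 := ⟨f' * d / p ^ (k + 1), by
      have h := Nat.div_add_mod (f' * d) (p ^ (k + 1)); rw [hd] at h; exact h.symm⟩
    rw [mul_comm d, hq, add_smul, one_smul, mul_comm, mul_smul, hPtors', smul_zero, zero_add]

include hw hΦ in
/-- **The same in the `B = M_∞[p^∞]` language of `Iwasawa/LocalTowerKernelCardLeTorsion`** (the
pointwise `hdiv`/divisibility shape that `PrimaryGroup.le_range_of_finite_ker` and
`X11b.TamagawaCoinvariants.natCard_primaryComponent_quotient_range_le` consume): with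
`M_∞ = E(K̄_v)^{Hi}` (`FixedPoints.addSubgroup`) and `B = M_∞[p^∞]` (`AddCommGroup.primaryComponent`),
every `b ∈ B` whose transport has non-singular reduction is `p • b'` for some `b' ∈ B` whose transport
has non-singular reduction — `B ∩ E₀` is `p`-divisible — provided `v ∤ p` is not split completely in
`K_∞/K`. [cite: GreenbergLNM1716, §3 Lemma 3.3 (proof, p. 87)] -/
theorem exists_nsmul_eq_of_mem_primaryComponent [W.IsElliptic] (hpv : (p : 𝓞 K) ∉ v.asIdeal)
    (hns : ∃ σ : absoluteGaloisGroup (v.adicCompletion K),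
      σ ∉ localSubgroup κ.kerSubgroup (v.adicCompletion K))
    (b : FixedPoints.addSubgroup (localSubgroup κ.kerSubgroup (v.adicCompletion K))
      (localPoints W (v.adicCompletion K)))
    (hb : b ∈ AddCommGroup.primaryComponent
      (FixedPoints.addSubgroup (localSubgroup κ.kerSubgroup (v.adicCompletion K))
        (localPoints W (v.adicCompletion K))) p)
    (hb₀ : ReducesToNonsingular w (IsLocalRing.residue w.integer)
      (Φ (b : localPoints W (v.adicCompletion K)))) :
    ∃ b' ∈ AddCommGroup.primaryComponent
        (FixedPoints.addSubgroup (localSubgroup κ.kerSubgroup (v.adicCompletion K))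
          (localPoints W (v.adicCompletion K))) p,
      ReducesToNonsingular w (IsLocalRing.residue w.integer)
        (Φ (b' : localPoints W (v.adicCompletion K))) ∧ p • b' = b := by
  have hbfix : ∀ σ ∈ localSubgroup κ.kerSubgroup (v.adicCompletion K),
      σ • (b : localPoints W (v.adicCompletion K)) = b := fun σ hσ ↦ b.2 ⟨σ, hσ⟩
  obtain ⟨k, hk⟩ := (AddCommGroup.mem_primaryComponent).mp hb
  have hk' : p ^ k • (b : localPoints W (v.adicCompletion K)) = 0 := by
    rw [← AddSubgroupClass.coe_nsmul, hk, ZeroMemClass.coe_zero]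
  obtain ⟨Q, hQfix, hQ₀, ⟨l, hl⟩, hQb⟩ :=
    exists_nsmul_eq_of_forall_smul_eq W κ hw hΦ hpv hns (b : localPoints W (v.adicCompletion K))
      hbfix hb₀ ⟨k, hk'⟩
  refine ⟨⟨Q, fun h ↦ hQfix h h.2⟩, (AddCommGroup.mem_primaryComponent).mpr ⟨l, Subtype.ext hl⟩,
    hQ₀, Subtype.ext ?_⟩
  rw [AddSubgroupClass.coe_nsmul]
  exact hQb

end Main


end Summit.BirchSwinnertonDyer.Rank1Residual.Iwasawa.NonsingularTower

end
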